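import Literature.NumberTheory.EllipticCurves.IwasawaOrderKernelRankProofs
import Summits.BirchSwinnertonDyer.BirchSwinnertonDyer.Theorems.TwoAdicConverseOrdLambdaHalfAtTwoShapiroPTDefs
import Summits.BirchSwinnertonDyer.BirchSwinnertonDyer.Theorems.TwoAdicConverseOrdLambdaHalfAtTwoPoitouTateTwoWaysAtTwo
import Mathlib.Algebra.Module.CharacterModule
import HarnessLib

/-!
# Route `TwoAdicConverse`, crux `OrdLambdaHalfAtTwo` (stmt-BirchSwinnertonDyer-19556), line `kato_determinant_greenberg_two`, stub 4″:
# the F3-S piece «λ-Shapiro for the fine duals» REDUCED IN THE KERNEL to a Galois-side quasi-decomposition of the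
# Selmer groups (pen RC-362 (B) TIER RULE t3: «EITHER proved in the kernel as module algebra (preferred) …»)

Seat `bsd-2adic-conv-1` GEN 29 (cell `pub/bsd-2adic`; `--supports stmt-BirchSwinnertonDyer-19556`).  HONEST FRAMING: BSD is not proved by
any of this; the crux is NOT proved here; this file is `Λ`-module algebra + Pontryagin duality, no Galois cohomology, nothing about any curve asserted.

## What is proved

The memo-tier binder `TwoAdicShapiroPT.LambdaShapiroFineAtTwo` (p682932) says `λ(X₀(W/K_∞)) = λ(X₀(W/ℚ_∞)) + λ(X₀(A/ℚ_∞))` for the fine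
Selmer duals (`2` split in the imaginary quadratic `K`, `A` the `K`-twist).  Its READING is «Shapiro + inflation–restriction give maps between
the SELMER GROUPS with kernel and cokernel killed by `[K:ℚ] = 2` (twice); `λ` is blind to exponent-`2` defects».  This file proves the second
half once and for all and thereby REDUCES the binder to the first:

* §1 `exists_dualMap_of_selmerQuasiDecomposition` (generic, any prime `p`): let `S_W`, `S_A` be `p`-primary abelian groups and `S_K` an abelian
  group («Selmer groups»), `Y_W`, `Y_A`, `X_K` `Λ`-modules given as PONTRYAGIN DUALS of `S_W`, `S_A`, `S_K` through bijective additive `toDual`'s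
  under which the constants `c ∈ ℤ_p ⊂ Λ` act through `ℤ_p → ℤ/p^k` on `p^k`-torsion classes (exactly the fields `toDual`/`bijective`/`toDual_C_smul`
  of the tree's `FineSelmerDualData` / `GreenbergStrictSelmerDualData` / `SelmerDualData`; the `T`-action plays NO role), and let
  `ρ_W : S_W → S_K`, `ρ_A : S_A → S_K` be additive maps with `ρ_W s + ρ_A s' = 0 ⟹ p^k s = 0 ∧ p^k s' = 0` and `p^k·S_K ≤ ρ_W(S_W) + ρ_A(S_A)`.
  Then the dual map `X_K → Y_W × Y_A` is additive, `C`-linear, with kernel AND cokernel killed by `p^k` (the cokernel bound extends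
  `p^k·(χ_W ⊕ χ_A)` from `(S_W × S_A) ⧸ ker ↪ S_K` to `S_K`, `ℚ/ℤ` being divisible — Mathlib's Baer criterion).
* §1 `lambdaInvariant_eq_lambdaInvariant_prod_of_selmerQuasiDecomposition`: hence `λ(X_K) = λ(Y_W × Y_A)` — the dual map becomes an
  isomorphism after `ℚ_p ⊗_{ℤ_p} −` (tree `Module.finrank_baseChange_eq_of_pow_smul`, `ℚ_p` flat over `ℤ_p`) and `λ = dim_{ℚ_p}(ℚ_p ⊗ −)`.
* §1 `isTorsion_and_lambdaInvariant_eq_add_of_selmerQuasiDecomposition`: if moreover `Y_W`, `Y_A` are finitely generated torsion `Λ`-modules, then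
  `X_K` is `Λ`-torsion (its `ℚ_p ⊗` is finite-dimensional: tree `IwasawaAlgebra.isTorsion_of_finite_baseChange`) and `λ(X_K) = λ(Y_W) + λ(Y_A)`.
* §2 `lambdaShapiroFine_of_selmerQuasiDecomposition_two`: the SPECIALISATION to the carriers of the binder — `Y_W : W.FineSelmerDualData κ γ`,
  `Y_A : A.FineSelmerDualData κ γ`, `Dfi : (W.baseChange K).GreenbergStrictSelmerDualData κK γK (GreenbergSelmer.fineData _ 2)` — : GIVEN additive
  `ρ_W : Sel₀(ℚ_∞, W[2^∞]) → Sel₀(K_∞, W_K[2^∞])`, `ρ_A : Sel₀(ℚ_∞, A[2^∞]) → Sel₀(K_∞, W_K[2^∞])` with kernel/cokernel bounds `2^k`, the binder's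
  conclusion holds for these data: `X₀(W_K/K_∞)` is torsion and `λ(X₀(W_K/K_∞)) = λ(X₀(W/ℚ_∞)) + λ(X₀(A/ℚ_∞))` (its `Module.Finite` conjunct is NOT
  a consequence of a quasi-decomposition — `lambdaShapiroFine_conclusion_of_selmerQuasiDecomposition_two` takes it as a hypothesis; in stub 4″ it
  comes from `π : X_Gr ↠ X_fine` and B2).  NO compatibility between the generators `γ`, `γK` is needed (`λ` only sees the `ℤ_p`-structure) —
  the design question of conv-1 GEN 28's BRIEF §0 disappears.

So (S) = [this file] + (S′) «the restriction / twisted-restriction maps `ρ_W`, `ρ_A` exist with `2²`-bounds» — a statement about Selmer GROUPS,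
clause by clause anchorable (`cor ∘ res = 2`, `res ∘ cor = 1 + σ` [NSW (1.5.7)], Shapiro's lemma [NSW (1.6.4)], local conditions at `w ∣ 2`
with `K_w = ℚ₂`), and provable inside ONE profinite group `Γ_ℚ ⊇ Gal(ℚ̄/K) ⊇ Gal(ℚ̄/K_∞)` with the tree's `resOfLe`/`cores` (next files of this
lane).  The kernel bound needs no Selmer-stability of `cor`: if `res s = −res' s'` lies in the `σ = +1` and `σ = −1` parts it is `2`-torsion, so
`4s = cor(res(2s)) = 0`; the cokernel bound: for `t ∈ Sel₀(K_∞)`, `2·cor t` satisfies the STRICT local conditions over `ℚ_∞` (restriction to an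
index-`≤ 2` subgroup has `2`-torsion kernel) and `res(2·cor t) = 2(1 + σ)t`, likewise `2(1 − σ)t` from the twist, so `4t ∈ im ρ_W + im ρ_A`.

References: L. Washington, GTM 83 §13.2 [Washington1997]; J. Neukirch, A. Schmidt, K. Wingberg, *Cohomology of Number Fields* (2008) (1.5.7),
(1.6.4) [NeukirchSchmidtWingberg2008]; R. Greenberg, LNM 1716 §1 (the `Λ`-structure of `Hom(Sel, ℚ_p/ℤ_p)`) [GreenbergLNM1716]; pen RC-362 (B);
conv-1 GEN 28 `BRIEF-19556-F3-typing-conv1-g28.md` §1; p682932 (the binder).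
-/

set_option linter.dupNamespace false
set_option autoImplicit false

noncomputable section

open scoped NumberField TensorProduct
open Function WeierstrassCurve NumberField IsDedekindDomain Field
open Literature.NumberTheory.EllipticCurves Literature.NumberTheory.GaloisRepresentations
open Summit.BirchSwinnertonDyer.BirchSwinnertonDyer.Theorems.TwoAdicPoitouTateTwoWays

namespace Summit.BirchSwinnertonDyer.BirchSwinnertonDyer.Theorems.TwoAdicShapiroPT

universe u v w x y z

/-! ## §1 Generic: `λ` through Pontryagin duals of a quasi-decomposition -/

section Generic

variable (p : ℕ) [Fact p.Prime]

/-- In a `Λ`-module, the constant `p^k ∈ ℤ_p ⊂ Λ` acts as the integer `p^k`. [folklore] -/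
theorem algebraMap_pow_smul_eq_nsmul {M : Type*} [AddCommGroup M] [Module (IwasawaAlgebra p) M] (k : ℕ) (x : M) :
    (algebraMap ℤ_[p] (IwasawaAlgebra p) ((p : ℤ_[p]) ^ k)) • x = (p ^ k : ℕ) • x := by
  rw [map_pow, map_natCast, ← Nat.cast_pow, Nat.cast_smul_eq_nsmul]

/-- For a Pontryagin-dual datum `d : X ≅ Hom(S, ℚ/ℤ)`: `d (n • x) s = d x (n • s)`. [folklore] -/
theorem toDual_nsmul_apply {X S : Type*} [AddCommGroup X] [AddCommGroup S] (d : X →+ (S →+ AddCircle (1 : ℚ)))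
    (n : ℕ) (x : X) (s : S) : d (n • x) s = d x (n • s) := by
  rw [map_nsmul, AddMonoidHom.nsmul_apply, map_nsmul]

variable {SW : Type u} {SA : Type v} {SK : Type w} [AddCommGroup SW] [AddCommGroup SA] [AddCommGroup SK]
  {YW : Type x} {YA : Type y} {XK : Type z}
  [AddCommGroup YW] [Module (IwasawaAlgebra p) YW]
  [AddCommGroup YA] [Module (IwasawaAlgebra p) YA]
  [AddCommGroup XK] [Module (IwasawaAlgebra p) XK]

/-- **The dual of a quasi-decomposition is a `C`-linear quasi-isomorphism.**  `S_W`, `S_A` `p`-primary abelian groups, `S_K` any; `Y_W`,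
`Y_A`, `X_K` `Λ`-modules with bijective additive `dW : Y_W ≅ Hom(S_W, ℚ/ℤ)`, `dA`, `dK : X_K ≅ Hom(S_K, ℚ/ℤ)` under which `C c` (`c ∈ ℤ_p`)
acts through `ℤ_p → ℤ/p^k` on `p^k`-torsion classes; `ρ_W : S_W → S_K`, `ρ_A : S_A → S_K` additive with
`ρ_W s + ρ_A s' = 0 ⟹ p^k s = 0 ∧ p^k s' = 0` and `∀ t, ∃ s s', p^k t = ρ_W s + ρ_A s'`.  Then the dual map
`x ↦ (dW⁻¹(dK x ∘ ρ_W), dA⁻¹(dK x ∘ ρ_A)) : X_K → Y_W × Y_A` is additive, commutes with every `C c` (so it is `ℤ_p`-LINEAR for the structure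
through which `λ` is defined), has kernel killed by `p^k` and cokernel killed by `p^k` (the cokernel bound extends `p^k·(χ_W ⊕ χ_A)` from
`(S_W × S_A) ⧸ ker ↪ S_K` to `S_K`: `ℚ/ℤ` is divisible — Baer).  [cite: GreenbergLNM1716, §1 (the Λ-module Hom(Sel, ℚ_p/ℤ_p); Pontryagin duality)] -/
theorem exists_dualMap_of_selmerQuasiDecomposition
    (hSW : ∀ s : SW, ∃ k : ℕ, p ^ k • s = 0) (hSA : ∀ s : SA, ∃ k : ℕ, p ^ k • s = 0)
    (dW : YW →+ (SW →+ AddCircle (1 : ℚ))) (hdW : Bijective dW)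
    (hdWC : ∀ (c : ℤ_[p]) (y : YW) (s : SW) (k : ℕ), p ^ k • s = 0 →
      dW (PowerSeries.C c • y) s = (PadicInt.toZModPow k c).val • dW y s)
    (dA : YA →+ (SA →+ AddCircle (1 : ℚ))) (hdA : Bijective dA)
    (hdAC : ∀ (c : ℤ_[p]) (y : YA) (s : SA) (k : ℕ), p ^ k • s = 0 →
      dA (PowerSeries.C c • y) s = (PadicInt.toZModPow k c).val • dA y s)
    (dK : XK →+ (SK →+ AddCircle (1 : ℚ))) (hdK : Bijective dK)
    (hdKC : ∀ (c : ℤ_[p]) (x : XK) (t : SK) (k : ℕ), p ^ k • t = 0 →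
      dK (PowerSeries.C c • x) t = (PadicInt.toZModPow k c).val • dK x t)
    (ρW : SW →+ SK) (ρA : SA →+ SK) (k : ℕ)
    (hker : ∀ (s : SW) (s' : SA), ρW s + ρA s' = 0 → p ^ k • s = 0 ∧ p ^ k • s' = 0)
    (hcoker : ∀ t : SK, ∃ (s : SW) (s' : SA), p ^ k • t = ρW s + ρA s') :
    ∃ φ : XK →+ YW × YA,
      (∀ x, dW (φ x).1 = (dK x).comp ρW ∧ dA (φ x).2 = (dK x).comp ρA) ∧
      (∀ (c : ℤ_[p]) (x : XK), φ (PowerSeries.C c • x) = PowerSeries.C c • φ x) ∧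
      (∀ x, φ x = 0 → (p ^ k : ℕ) • x = 0) ∧
      (∀ y, ∃ x, (p ^ k : ℕ) • y = φ x) := by
  classical
  let eW : YW ≃+ (SW →+ AddCircle (1 : ℚ)) := AddEquiv.ofBijective dW hdW
  let eA : YA ≃+ (SA →+ AddCircle (1 : ℚ)) := AddEquiv.ofBijective dA hdA
  let eK : XK ≃+ (SK →+ AddCircle (1 : ℚ)) := AddEquiv.ofBijective dK hdK
  -- the dual map `x ↦ (dW⁻¹ (dK x ∘ ρ_W), dA⁻¹ (dK x ∘ ρ_A))`
  let φ₀ : XK →+ YW × YA :=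
    { toFun := fun x ↦ (eW.symm ((dK x).comp ρW), eA.symm ((dK x).comp ρA))
      map_zero' := by
        simp only [map_zero, AddMonoidHom.zero_comp, Prod.mk_eq_zero, and_self]
      map_add' := fun x x' ↦ by
        simp only [map_add, AddMonoidHom.add_comp, Prod.mk_add_mk] }
  have hφ₀W : ∀ x, dW (φ₀ x).1 = (dK x).comp ρW := fun x ↦ eW.apply_symm_apply _
  have hφ₀A : ∀ x, dA (φ₀ x).2 = (dK x).comp ρA := fun x ↦ eA.apply_symm_apply _
  refine ⟨φ₀, fun x ↦ ⟨hφ₀W x, hφ₀A x⟩, fun c x ↦ ?_, fun x hx ↦ ?_, fun y ↦ ?_⟩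
  · -- `C c`-linearity
    refine Prod.ext (hdW.1 ?_) (hdA.1 ?_)
    · rw [Prod.smul_fst, hφ₀W]
      ext s
      obtain ⟨j, hj⟩ := hSW s
      have hj' : p ^ j • ρW s = 0 := by rw [← map_nsmul, hj, map_zero]
      rw [AddMonoidHom.comp_apply, hdKC c x (ρW s) j hj', hdWC c _ s j hj, hφ₀W, AddMonoidHom.comp_apply]
    · rw [Prod.smul_snd, hφ₀A]
      ext s
      obtain ⟨j, hj⟩ := hSA s
      have hj' : p ^ j • ρA s = 0 := by rw [← map_nsmul, hj, map_zero]
      rw [AddMonoidHom.comp_apply, hdKC c x (ρA s) j hj', hdAC c _ s j hj, hφ₀A, AddMonoidHom.comp_apply]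
  · -- kernel killed by `p^k`
    have hxW : (dK x).comp ρW = 0 := by rw [← hφ₀W, hx, Prod.fst_zero, map_zero]
    have hxA : (dK x).comp ρA = 0 := by rw [← hφ₀A, hx, Prod.snd_zero, map_zero]
    refine hdK.1 ?_
    rw [map_zero]
    ext t
    obtain ⟨s, s', hss'⟩ := hcoker t
    rw [toDual_nsmul_apply, hss', map_add, ← AddMonoidHom.comp_apply, ← AddMonoidHom.comp_apply, hxW, hxA,
      AddMonoidHom.zero_apply, AddMonoidHom.zero_apply, add_zero, AddMonoidHom.zero_apply]
  · -- cokernel killed by `p^k`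
    obtain ⟨yW, yA⟩ := y
    -- the character `ψ = χ_W ⊕ χ_A` of `S_W × S_A`, multiplied by `p^k`, kills `ker(ρ_W ⊕ ρ_A)`
    let ρ : SW × SA →+ SK := ρW.coprod ρA
    let ψ : SW × SA →+ AddCircle (1 : ℚ) := (dW yW).coprod (dA yA)
    have hψ : ρ.ker ≤ ((p ^ k : ℕ) • ψ).ker := by
      rintro ⟨s, s'⟩ hs
      have hs' : ρW s + ρA s' = 0 := by
        rw [AddMonoidHom.mem_ker, AddMonoidHom.coprod_apply] at hs
        exact hs
      obtain ⟨h1, h2⟩ := hker s s' hs'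
      rw [AddMonoidHom.mem_ker, AddMonoidHom.nsmul_apply, ← map_nsmul, Prod.smul_mk, h1, h2, Prod.mk_zero_zero, map_zero]
    -- extend `p^k ψ` from `(S_W × S_A) ⧸ ker ρ ↪ S_K` to `S_K` (`ℚ/ℤ` is divisible)
    obtain ⟨θ, hθ⟩ := (Module.Baer.of_divisible (AddCircle (1 : ℚ))).extension_property_addMonoidHom
      (QuotientAddGroup.kerLift ρ) (QuotientAddGroup.kerLift_injective ρ) (QuotientAddGroup.lift ρ.ker ((p ^ k : ℕ) • ψ) hψ)
    have hθρ : ∀ q : SW × SA, θ (ρ q) = (p ^ k : ℕ) • ψ q := fun q ↦ by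
      rw [← QuotientAddGroup.kerLift_mk ρ q, ← AddMonoidHom.comp_apply, hθ, QuotientAddGroup.lift_mk, AddMonoidHom.nsmul_apply]
    have hθW : ∀ s : SW, θ (ρW s) = (p ^ k : ℕ) • dW yW s := fun s ↦ by
      have h := hθρ (s, 0)
      simp only [ρ, ψ, AddMonoidHom.coprod_apply, map_zero, add_zero] at h
      exact h
    have hθA : ∀ s : SA, θ (ρA s) = (p ^ k : ℕ) • dA yA s := fun s ↦ by
      have h := hθρ (0, s)
      simp only [ρ, ψ, AddMonoidHom.coprod_apply, map_zero, zero_add] at h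
      exact h
    refine ⟨eK.symm θ, ?_⟩
    have hxθ : dK (eK.symm θ) = θ := eK.apply_symm_apply θ
    rw [Prod.smul_mk]
    refine Prod.ext (hdW.1 ?_) (hdA.1 ?_)
    · show dW ((p ^ k : ℕ) • yW) = dW (φ₀ (eK.symm θ)).1
      rw [hφ₀W, hxθ]
      ext s
      rw [AddMonoidHom.comp_apply, hθW, toDual_nsmul_apply, map_nsmul]
    · show dA ((p ^ k : ℕ) • yA) = dA (φ₀ (eK.symm θ)).2
      rw [hφ₀A, hxθ]
      ext s
      rw [AddMonoidHom.comp_apply, hθA, toDual_nsmul_apply, map_nsmul]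

/-- **`λ` of Pontryagin duals along a quasi-decomposition of `p`-primary groups.**  Under the hypotheses of
`exists_dualMap_of_selmerQuasiDecomposition`: `λ(X_K) = λ(Y_W × Y_A)` — `ℚ_p ⊗_{ℤ_p}` of the dual map is bijective (tree
`Module.finrank_baseChange_eq_of_pow_smul`, `ℚ_p` flat over `ℤ_p`) and `λ = dim_{ℚ_p}(ℚ_p ⊗_{ℤ_p} −)`.
[cite: Washington1997, §13.2 (λ = rank over ℤ_p modulo p-power torsion)] [cite: GreenbergLNM1716, §1 (the Λ-module Hom(Sel, ℚ_p/ℤ_p))] -/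
theorem lambdaInvariant_eq_lambdaInvariant_prod_of_selmerQuasiDecomposition
    (hSW : ∀ s : SW, ∃ k : ℕ, p ^ k • s = 0) (hSA : ∀ s : SA, ∃ k : ℕ, p ^ k • s = 0)
    (dW : YW →+ (SW →+ AddCircle (1 : ℚ))) (hdW : Bijective dW)
    (hdWC : ∀ (c : ℤ_[p]) (y : YW) (s : SW) (k : ℕ), p ^ k • s = 0 →
      dW (PowerSeries.C c • y) s = (PadicInt.toZModPow k c).val • dW y s)
    (dA : YA →+ (SA →+ AddCircle (1 : ℚ))) (hdA : Bijective dA)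
    (hdAC : ∀ (c : ℤ_[p]) (y : YA) (s : SA) (k : ℕ), p ^ k • s = 0 →
      dA (PowerSeries.C c • y) s = (PadicInt.toZModPow k c).val • dA y s)
    (dK : XK →+ (SK →+ AddCircle (1 : ℚ))) (hdK : Bijective dK)
    (hdKC : ∀ (c : ℤ_[p]) (x : XK) (t : SK) (k : ℕ), p ^ k • t = 0 →
      dK (PowerSeries.C c • x) t = (PadicInt.toZModPow k c).val • dK x t)
    (ρW : SW →+ SK) (ρA : SA →+ SK) (k : ℕ)
    (hker : ∀ (s : SW) (s' : SA), ρW s + ρA s' = 0 → p ^ k • s = 0 ∧ p ^ k • s' = 0)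
    (hcoker : ∀ t : SK, ∃ (s : SW) (s' : SA), p ^ k • t = ρW s + ρA s') :
    lambdaInvariant p XK = lambdaInvariant p (YW × YA) := by
  obtain ⟨φ₀, -, hC, hker₀, hcoker₀⟩ := exists_dualMap_of_selmerQuasiDecomposition p hSW hSA dW hdW hdWC dA hdA hdAC
    dK hdK hdKC ρW ρA k hker hcoker
  -- the `ℤ_p`-structures (definitionally those of `RestrictScalars ℤ_p Λ _`, through which `λ` is defined)
  letI : Module ℤ_[p] XK := Module.compHom XK (algebraMap ℤ_[p] (IwasawaAlgebra p))
  letI : Module ℤ_[p] (YW × YA) := Module.compHom (YW × YA) (algebraMap ℤ_[p] (IwasawaAlgebra p))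
  haveI : Module.Flat ℤ_[p] ℚ_[p] := IsLocalization.flat ℚ_[p] (nonZeroDivisors ℤ_[p])
  let φ : XK →ₗ[ℤ_[p]] YW × YA :=
    { φ₀ with
      map_smul' := fun c x ↦ by
        change φ₀ ((algebraMap ℤ_[p] (IwasawaAlgebra p) c) • x) = (algebraMap ℤ_[p] (IwasawaAlgebra p) c) • φ₀ x
        rw [PowerSeries.algebraMap_eq]
        exact hC c x }
  have hkerφ : ∀ x, φ x = 0 → ∃ n : ℕ, ((p : ℤ_[p]) ^ n) • x = 0 := fun x hx ↦ ⟨k, by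
    change (algebraMap ℤ_[p] (IwasawaAlgebra p) ((p : ℤ_[p]) ^ k)) • x = 0
    rw [algebraMap_pow_smul_eq_nsmul]
    exact hker₀ x hx⟩
  have hcokerφ : ∀ y, ∃ (n : ℕ) (x : XK), ((p : ℤ_[p]) ^ n) • y = φ x := fun y ↦ by
    obtain ⟨x, hx⟩ := hcoker₀ y
    refine ⟨k, x, ?_⟩
    change (algebraMap ℤ_[p] (IwasawaAlgebra p) ((p : ℤ_[p]) ^ k)) • y = φ₀ x
    rw [algebraMap_pow_smul_eq_nsmul]
    exact hx
  -- elaborate WITHOUT the expected type, then close by `rfl`-transparency (`λ` is `dim ℚ_p ⊗ RestrictScalars ℤ_p Λ _`, whose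
  -- `ℤ_p`-structure is `Module.compHom _ (algebraMap ℤ_p Λ)` definitionally) — the tree's pattern in `lambdaInvariant_quotient_eq_of_finite`
  have key := Module.finrank_baseChange_eq_of_pow_smul ℚ_[p] (isUnit_algebraMap_p p) φ hkerφ hcokerφ
  exact key

/-- A product of two torsion `Λ`-modules is torsion. [folklore] -/
theorem isTorsion_prod (hW : Module.IsTorsion (IwasawaAlgebra p) YW) (hA : Module.IsTorsion (IwasawaAlgebra p) YA) :
    Module.IsTorsion (IwasawaAlgebra p) (YW × YA) := by
  rintro ⟨y, y'⟩
  obtain ⟨a, ha⟩ := @hW y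
  obtain ⟨b, hb⟩ := @hA y'
  refine ⟨a * b, ?_⟩
  rw [Submonoid.smul_def, Submonoid.coe_mul, Prod.smul_mk, Prod.mk_eq_zero]
  rw [Submonoid.smul_def] at ha hb
  constructor
  · rw [mul_comm, mul_smul, ha, smul_zero]
  · rw [mul_smul, hb, smul_zero]

/-- **The same with finitely generated torsion `Y_W`, `Y_A`: `X_K` is `Λ`-torsion and `λ(X_K) = λ(Y_W) + λ(Y_A)`.**  Torsion: `ℚ_p ⊗ X_K ≅
ℚ_p ⊗ (Y_W × Y_A)` is finite-dimensional (tree `IwasawaAlgebra.finite_baseChange_of_isTorsion`), and a `Λ`-module with finite-dimensional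
`ℚ_p ⊗` is torsion (tree `IwasawaAlgebra.isTorsion_of_finite_baseChange`); the sum by `λ(Y_W × Y_A) = λ(Y_W) + λ(Y_A)`.  Finite
generation of `X_K` over `Λ` is NOT a consequence (and is not claimed).
[cite: Washington1997, §13.2] [cite: GreenbergLNM1716, §1] -/
theorem isTorsion_and_lambdaInvariant_eq_add_of_selmerQuasiDecomposition
    [Module.Finite (IwasawaAlgebra p) YW] [Module.Finite (IwasawaAlgebra p) YA]
    (hYW : Module.IsTorsion (IwasawaAlgebra p) YW) (hYA : Module.IsTorsion (IwasawaAlgebra p) YA)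
    (hSW : ∀ s : SW, ∃ k : ℕ, p ^ k • s = 0) (hSA : ∀ s : SA, ∃ k : ℕ, p ^ k • s = 0)
    (dW : YW →+ (SW →+ AddCircle (1 : ℚ))) (hdW : Bijective dW)
    (hdWC : ∀ (c : ℤ_[p]) (y : YW) (s : SW) (k : ℕ), p ^ k • s = 0 →
      dW (PowerSeries.C c • y) s = (PadicInt.toZModPow k c).val • dW y s)
    (dA : YA →+ (SA →+ AddCircle (1 : ℚ))) (hdA : Bijective dA)
    (hdAC : ∀ (c : ℤ_[p]) (y : YA) (s : SA) (k : ℕ), p ^ k • s = 0 →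
      dA (PowerSeries.C c • y) s = (PadicInt.toZModPow k c).val • dA y s)
    (dK : XK →+ (SK →+ AddCircle (1 : ℚ))) (hdK : Bijective dK)
    (hdKC : ∀ (c : ℤ_[p]) (x : XK) (t : SK) (k : ℕ), p ^ k • t = 0 →
      dK (PowerSeries.C c • x) t = (PadicInt.toZModPow k c).val • dK x t)
    (ρW : SW →+ SK) (ρA : SA →+ SK) (k : ℕ)
    (hker : ∀ (s : SW) (s' : SA), ρW s + ρA s' = 0 → p ^ k • s = 0 ∧ p ^ k • s' = 0)
    (hcoker : ∀ t : SK, ∃ (s : SW) (s' : SA), p ^ k • t = ρW s + ρA s') :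
    Module.IsTorsion (IwasawaAlgebra p) XK ∧
      lambdaInvariant p XK = lambdaInvariant p YW + lambdaInvariant p YA := by
  have hprod : Module.IsTorsion (IwasawaAlgebra p) (YW × YA) := isTorsion_prod p hYW hYA
  have hlam := lambdaInvariant_eq_lambdaInvariant_prod_of_selmerQuasiDecomposition p hSW hSA dW hdW hdWC dA hdA hdAC
    dK hdK hdKC ρW ρA k hker hcoker
  refine ⟨?_, by rw [hlam, lambdaInvariant_prod p hprod]⟩
  obtain ⟨φ₀, -, hC, hker₀, hcoker₀⟩ := exists_dualMap_of_selmerQuasiDecomposition p hSW hSA dW hdW hdWC dA hdA hdAC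
    dK hdK hdKC ρW ρA k hker hcoker
  letI : Module ℤ_[p] XK := Module.compHom XK (algebraMap ℤ_[p] (IwasawaAlgebra p))
  haveI : IsScalarTower ℤ_[p] (IwasawaAlgebra p) XK := IsScalarTower.of_compHom ℤ_[p] _ _
  letI : Module ℤ_[p] (YW × YA) := Module.compHom (YW × YA) (algebraMap ℤ_[p] (IwasawaAlgebra p))
  haveI : IsScalarTower ℤ_[p] (IwasawaAlgebra p) (YW × YA) := IsScalarTower.of_compHom ℤ_[p] _ _
  haveI : Module.Flat ℤ_[p] ℚ_[p] := IsLocalization.flat ℚ_[p] (nonZeroDivisors ℤ_[p])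
  let φ : XK →ₗ[ℤ_[p]] YW × YA :=
    { φ₀ with
      map_smul' := fun c x ↦ by
        change φ₀ ((algebraMap ℤ_[p] (IwasawaAlgebra p) c) • x) = (algebraMap ℤ_[p] (IwasawaAlgebra p) c) • φ₀ x
        rw [PowerSeries.algebraMap_eq]
        exact hC c x }
  have hkerφ : ∀ x, φ x = 0 → ∃ n : ℕ, ((p : ℤ_[p]) ^ n) • x = 0 := fun x hx ↦ ⟨k, by
    change (algebraMap ℤ_[p] (IwasawaAlgebra p) ((p : ℤ_[p]) ^ k)) • x = 0
    rw [algebraMap_pow_smul_eq_nsmul]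
    exact hker₀ x hx⟩
  have hcokerφ : ∀ y, ∃ (n : ℕ) (x : XK), ((p : ℤ_[p]) ^ n) • y = φ x := fun y ↦ by
    obtain ⟨x, hx⟩ := hcoker₀ y
    refine ⟨k, x, ?_⟩
    change (algebraMap ℤ_[p] (IwasawaAlgebra p) ((p : ℤ_[p]) ^ k)) • y = φ₀ x
    rw [algebraMap_pow_smul_eq_nsmul]
    exact hx
  have hbij := Module.bijective_baseChange_of_pow_smul ℚ_[p] (isUnit_algebraMap_p p) φ hkerφ hcokerφ
  haveI : Module.Finite ℚ_[p] (ℚ_[p] ⊗[ℤ_[p]] (YW × YA)) := IwasawaAlgebra.finite_baseChange_of_isTorsion p hprod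
  haveI : Module.Finite ℚ_[p] (ℚ_[p] ⊗[ℤ_[p]] XK) := Module.Finite.equiv (LinearEquiv.ofBijective _ hbij).symm
  exact IwasawaAlgebra.isTorsion_of_finite_baseChange p (M := XK)

end Generic

/-! ## §2 On the carriers of the binder `LambdaShapiroFineAtTwo` (p682932): (S) ⟸ a quasi-decomposition of the fine Selmer GROUPS -/

section Two

variable {W : WeierstrassCurve ℚ} [W.IsElliptic] {K : Type} [Field K] [NumberField K]
  {A : WeierstrassCurve ℚ} [A.IsElliptic]
  {κ : ZpExtension ℚ 2} {γ : absoluteGaloisGroup ℚ} {κK : ZpExtension K 2} {γK : absoluteGaloisGroup K}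

/-- Every class of `Sel₀(ℚ_∞, E[2^∞])` is killed by a power of `2` (it lives in `H¹(ℚ_∞, E[2^∞])`, tree
`WeierstrassCurve.exists_pow_smul_subgroupH1_ker_eq_zero`). [cite: GreenbergLNM1716, §1] -/
theorem exists_pow_smul_fineSelmerInfty_eq_zero (V : WeierstrassCurve ℚ) [V.IsElliptic] (s : V.fineSelmerInfty κ) :
    ∃ k : ℕ, 2 ^ k • s = 0 := by
  obtain ⟨k, hk⟩ := V.exists_pow_smul_subgroupH1_ker_eq_zero κ (s : V.subgroupH1 2 κ.kerSubgroup)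
  exact ⟨k, Subtype.ext (by rw [AddSubgroupClass.coe_nsmul]; exact hk)⟩

/-- **(S) REDUCED: λ-Shapiro for the fine duals from a quasi-decomposition of the fine Selmer groups.**  On the binder's carriers —
`Y_W = X₀(W/ℚ_∞)`, `Y_A = X₀(A/ℚ_∞)` (finitely generated torsion), `Dfi = X₀(W_K/K_∞)` (the Greenberg strict dual for the fine data) —
GIVEN additive maps `ρ_W : Sel₀(ℚ_∞, W[2^∞]) → Sel₀(K_∞, W_K[2^∞])` and `ρ_A : Sel₀(ℚ_∞, A[2^∞]) → Sel₀(K_∞, W_K[2^∞])` (intended: restriction,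
resp. restriction after the `K_∞`-isomorphism `A[2^∞] ≅ W[2^∞]`) with `ρ_W s + ρ_A s' = 0 ⟹ 2^k s = 0 ∧ 2^k s' = 0` and
`2^k · Sel₀(K_∞, W_K[2^∞]) ≤ im ρ_W + im ρ_A` (intended `k = 2`: `cor ∘ res = 2`, `res ∘ cor = 1 + σ`, images in the `σ = ±1` parts), THEN
`X₀(W_K/K_∞)` is `Λ`-torsion and **`λ(X₀(W_K/K_∞)) = λ(X₀(W/ℚ_∞)) + λ(X₀(A/ℚ_∞))`**.  No relation between the generators `γ`, `γK` is
needed.  (`Module.Finite Λ X₀(W_K/K_∞)` is not a consequence; in stub 4″ it follows from `π : X_Gr ↠ X_fine` and B2.)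
[cite: Washington1997, §13.2] [cite: GreenbergLNM1716, §1] [cite: NeukirchSchmidtWingberg2008, (1.5.7) and (1.6.4) (the intended ρ's; shape only)] -/
theorem lambdaShapiroFine_of_selmerQuasiDecomposition_two
    (Y_W : W.FineSelmerDualData κ γ) (Y_A : A.FineSelmerDualData κ γ)
    (Dfi : (W.baseChange K).GreenbergStrictSelmerDualData κK γK
      (GreenbergSelmer.fineData (↥((W.baseChange K).geomPrimaryTorsion 2)) 2))
    [Module.Finite (IwasawaAlgebra 2) Y_W.X] [Module.Finite (IwasawaAlgebra 2) Y_A.X]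
    (hW : Module.IsTorsion (IwasawaAlgebra 2) Y_W.X) (hA : Module.IsTorsion (IwasawaAlgebra 2) Y_A.X)
    (ρW : W.fineSelmerInfty κ →+
      GreenbergSelmer.strictSelmerInfty κK (↥((W.baseChange K).geomPrimaryTorsion 2))
        (GreenbergSelmer.fineData (↥((W.baseChange K).geomPrimaryTorsion 2)) 2))
    (ρA : A.fineSelmerInfty κ →+
      GreenbergSelmer.strictSelmerInfty κK (↥((W.baseChange K).geomPrimaryTorsion 2))
        (GreenbergSelmer.fineData (↥((W.baseChange K).geomPrimaryTorsion 2)) 2))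
    (k : ℕ)
    (hker : ∀ (s : W.fineSelmerInfty κ) (s' : A.fineSelmerInfty κ), ρW s + ρA s' = 0 → 2 ^ k • s = 0 ∧ 2 ^ k • s' = 0)
    (hcoker : ∀ t, ∃ (s : W.fineSelmerInfty κ) (s' : A.fineSelmerInfty κ), 2 ^ k • t = ρW s + ρA s') :
    Module.IsTorsion (IwasawaAlgebra 2) Dfi.X ∧
      lambdaInvariant 2 Dfi.X = lambdaInvariant 2 Y_W.X + lambdaInvariant 2 Y_A.X :=
  isTorsion_and_lambdaInvariant_eq_add_of_selmerQuasiDecomposition 2 hW hA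
    (exists_pow_smul_fineSelmerInfty_eq_zero W) (exists_pow_smul_fineSelmerInfty_eq_zero A)
    Y_W.toDual Y_W.bijective Y_W.toDual_C_smul Y_A.toDual Y_A.bijective Y_A.toDual_C_smul
    Dfi.toDual Dfi.bijective Dfi.toDual_C_smul ρW ρA k hker hcoker

/-- **The binder's conclusion, verbatim, from a quasi-decomposition plus finite generation of `X₀(W_K/K_∞)`** (the shape consumed by
`ShapiroKatoGreenbergDatum.katoIndex`): `(Module.Finite ∧ IsTorsion) ∧ λ(X₀(W_K/K_∞)) = λ(X₀(W/ℚ_∞)) + λ(X₀(A/ℚ_∞))`.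
[cite: Washington1997, §13.2] [cite: GreenbergLNM1716, §1] -/
theorem lambdaShapiroFine_conclusion_of_selmerQuasiDecomposition_two
    (Y_W : W.FineSelmerDualData κ γ) (Y_A : A.FineSelmerDualData κ γ)
    (Dfi : (W.baseChange K).GreenbergStrictSelmerDualData κK γK
      (GreenbergSelmer.fineData (↥((W.baseChange K).geomPrimaryTorsion 2)) 2))
    [Module.Finite (IwasawaAlgebra 2) Y_W.X] [Module.Finite (IwasawaAlgebra 2) Y_A.X]
    (hW : Module.IsTorsion (IwasawaAlgebra 2) Y_W.X) (hA : Module.IsTorsion (IwasawaAlgebra 2) Y_A.X)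
    (hfin : Module.Finite (IwasawaAlgebra 2) Dfi.X)
    (ρW : W.fineSelmerInfty κ →+
      GreenbergSelmer.strictSelmerInfty κK (↥((W.baseChange K).geomPrimaryTorsion 2))
        (GreenbergSelmer.fineData (↥((W.baseChange K).geomPrimaryTorsion 2)) 2))
    (ρA : A.fineSelmerInfty κ →+
      GreenbergSelmer.strictSelmerInfty κK (↥((W.baseChange K).geomPrimaryTorsion 2))
        (GreenbergSelmer.fineData (↥((W.baseChange K).geomPrimaryTorsion 2)) 2))
    (k : ℕ)
    (hker : ∀ (s : W.fineSelmerInfty κ) (s' : A.fineSelmerInfty κ), ρW s + ρA s' = 0 → 2 ^ k • s = 0 ∧ 2 ^ k • s' = 0)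
    (hcoker : ∀ t, ∃ (s : W.fineSelmerInfty κ) (s' : A.fineSelmerInfty κ), 2 ^ k • t = ρW s + ρA s') :
    (Module.Finite (IwasawaAlgebra 2) Dfi.X ∧ Module.IsTorsion (IwasawaAlgebra 2) Dfi.X) ∧
      lambdaInvariant 2 Dfi.X = lambdaInvariant 2 Y_W.X + lambdaInvariant 2 Y_A.X := by
  obtain ⟨htor, hlam⟩ := lambdaShapiroFine_of_selmerQuasiDecomposition_two Y_W Y_A Dfi hW hA ρW ρA k hker hcoker
  exact ⟨⟨hfin, htor⟩, hlam⟩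

end Two

end Summit.BirchSwinnertonDyer.BirchSwinnertonDyer.Theorems.TwoAdicShapiroPT

end
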